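import HarnessLib
import Summits.HodgeConjecture.HodgeConjecture.Cruxes.H413.Lines.K2_E3_EllipticInputsSigs_U12Characters   -- MAIN (ED. 38+): rows 9 ∕ 10 ∕ U12-g ★, (11-2-nonsplit), `charLocIntNearSemisimple_three_nonsplit_of_leaves`, «LIE» (LBGL∕LBU N = 2 ★, (12D-le2) ★)
import Summits.HodgeConjecture.HodgeConjecture.Cruxes.H413.Lines.K2_E3_EllipticInputsSigs_Lie3b              -- PART «LIE3b» ED. 1: head `normalizedCharBddNearSingularDescentThreeNonsplit_of_sigs` ((12D-3) + hns)
import Summits.HodgeConjecture.HodgeConjecture.Theorems.K2E3CharLettersLeThreeDefs                            -- ★ p861200: hHC₃ ∕ hHCB₃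
import Summits.HodgeConjecture.HodgeConjecture.Theorems.K2E3CharLocIntOfLocalLeThree                          -- ★ p861569: hHC₃ ⟸ U12-g + row 10 + row 11₃ + row 9₃
import Summits.HodgeConjecture.HodgeConjecture.Theorems.K2E3CharLocBddOfLocalLeThree                          -- ★ p861574: hHCB₃ ⟸ row 10 + row 12₃
import Summits.HodgeConjecture.HodgeConjecture.Theorems.K2E3NormalizedCharBddOnCayleySliceOfLieCoreFixedLeThree   -- 📤 p861774: glue₃ (§3 row 12₃ ⟸ U12-g + (L-A_U)′₃ + (L-B_U)′₃ + (12-D)₃)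
import Summits.HodgeConjecture.HodgeConjecture.Cruxes.H413.Lines.K2_E3_EllipticInputsSigs_U12CharactersLieA3   -- PART «LIEA3» (K2E3-typ2): (LAU-2) `sig_K2E3ULieCharExpansionAtOneTwo`, (LAU-3) `…Three`
import Summits.HodgeConjecture.HodgeConjecture.Cruxes.H413.Lines.K2_E3_EllipticInputsSigs_U12CharactersLie3    -- PART «LIE3» (K2E3-typ2): (LBU-3) `sig_K2E3UNilpotentFourierRegularThree`

/-!
# K2_E3_EllipticInputs ∕ U12Characters — PART «U12Characters₃» (NR-1′ re-cut `2 ≤ N ≤ 3`, `v` non-split) — ED. 1 (architect K2E3-p25 (g3) cand, 2026-09-04; pen K2E3-plan (g5))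

W4-3 of the NR-1′ wave, pre-composed by the architect and kernel-checked by K2E3-r02 (g5) in its stand-in form: the NR-1′ letters hHC₃
`K2E3CharLettersLeThreeDefs.characterLocallyIntegrableLeThree` and hHCB₃ `…normalizedCharacter_locallyBoundedLeThree` (tier-0 ED. 4 `stub_charLocInt` ∕ `stub_charLocBdd`)
from the U12 rows RE-CUT to `2 ≤ N ≤ 3`, `v` non-split, every tie BY NAME over ★ payers and the by-`N` letters of PARTS «LIEA3» ∕ «LIE3» ∕ «LIE3b»:
* PEN FORM (no `sorry` in this file): (LAU-2) `sig_K2E3ULieCharExpansionAtOneTwo`, (LAU-3) `…Three` come from PART «LIEA3», (LBU-3) `sig_K2E3UNilpotentFourierRegularThree` from PART «LIE3»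
  (both K2E3-typ2 (g0), imported above; same namespace) — this PART is sorry-free and REL over exactly their sockets + LIE3b's (12D-3U).
* §1 (L-A_U)′₃ `uLieCharExpansionAtOne_leThree` ⟸ (LAU-2) ∣ (LAU-3) · §2 (L-B_U)′₃ `uNilpotentFourierRegular_leThree` ⟸ ★ «LIE» ED. 14 `N = 2` body ∣ (LBU-3) ·
  §3 (12-D)₃ `normalizedCharBddNearSingularDescent_leThree` ⟸ ★ (12D-le2) ∣ «LIE3b» head `normalizedCharBddNearSingularDescentThreeNonsplit_of_sigs` ·
  §4 ROW 12₃ `sig_K2E3NormalizedCharBddNearSemisimpleLeThree` := glue₃ §3 · §5 ROW 11₃ `sig_K2E3CharLocIntNearSemisimpleLeThree` ⟸ (11-2-nonsplit) ∣ `charLocIntNearSemisimple_three_nonsplit_of_leaves` ·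
  §6 ROW 9₃ `sig_K2E3CharLocConstOnRegularSetLeThree` := restriction of ★ row 9 · §7 THE LETTERS: `charLocInt_of_sigs₃ : hHC₃`, `charLocBdd_of_sigs₃ : hHCB₃`.
Statements of §1–§6 = the hypothesis texts of the ★ twins (bracket-extracted by `K2/K2E3-p25/g3/nr1/mk_main3.py`), so every composition is syntactic.
ACCOUNTING after the pen (tier-0 ED. 4 + this PART tied): hHC₃ REL over EXACTLY {(11-3ns-res), (res-ω) via (11-2-nonsplit)'s road, (S0IRR♭)… = row 11's N ≤ 3 non-split leaves};
hHCB₃ REL over EXACTLY {(LAU-2), (LAU-3), (LBU-3), (12D-3U), (12D-3tr)} — the GL-side (L-A_GL)∕(L-B_GL)∕(LBGL-ge4), (LAU-le1)∕(LAU-ge4), (LBU-ge4), (12D-ge4), (12D-3split), (11-ge4), (11-3-split-*)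
are OFF the letters' cone.  HONEST LABEL: HC_CM is proved only modulo the 7 printed citations (2 remaining named inputs: hLiu418 = stmt-HodgeConjecture-24832, h413 =
stmt-HodgeConjecture-24833) until rung 0 closes; REL ≠ ★; dry-run, count-neutral.
-/

set_option linter.dupNamespace false

noncomputable section

open NumberField IsDedekindDomain MeasureTheory
open scoped Matrix MatrixGroups Valued NNReal
open Literature.NumberTheory.Rogawski1990 Literature.NumberTheory.Automorphic Literature.NumberTheory.Automorphic.UnitaryGroup
open Literature.NumberTheory.Automorphic.UnitaryGroup.CotangentForms Literature.NumberTheory.GaloisRepresentations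
open Literature.NumberTheory.Automorphic.Arthur2013.Leaves.TECR
open Summit.HodgeConjecture.HodgeConjecture.Cruxes.H413.F0P3cStCharTSPaydown

namespace Summit.HodgeConjecture.HodgeConjecture.Cruxes.H413.K2E3EllipticInputs.U12Characters

/-! ## §1 (L-A_U)′₃ ⟸ (LAU-2) ∣ (LAU-3) -/

set_option maxHeartbeats 1600000 in
set_option synthInstance.maxHeartbeats 400000 in
open scoped Classical in
open MeasureTheory.Measure Filter Topology Polynomial Literature.NumberTheory.GaloisRepresentations.IsNonarchimedeanLocalField Summit.HodgeConjecture.HodgeConjecture.Cruxes.H413.K2E3LieUnitary in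
/-- **(L-A_U)′₃** — the `hAU` hypothesis of ★ glue₃ `K2E3NormalizedCharBddOnCayleySliceOfLieCoreFixedLeThree` VERBATIM, tied by `N`. -/
theorem uLieCharExpansionAtOne_leThree :
    ∀ (L : Type) [Field L] [NumberField L] [IsCMField L] (N : ℕ), 2 ≤ N → N ≤ 3 → ∀ (H : Matrix (Fin N) (Fin N) L),
      (H.map (cmConjRingHom L))ᵀ = H → H.det ≠ 0 →
      ∀ (v : HeightOneSpectrum (𝓞 ↥(maximalRealSubfield L))) (w : UnitaryGroup.PlacesOver L v) (hw : IsCMField.complexConj L • w.1 = w.1)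
      (ψ : AddChar (w.1.adicCompletion L) Circle), ψ.IsContinuousNontrivial →
      (∃ a : w.1.adicCompletion L, galAdicCompletionMap (L := L) (IsCMField.complexConj L) hw a = a ∧ ψ a ≠ 1) →
      ∀ [MeasurableSpace ↥(lieOfForm (galAdicCompletionMap (L := L) (IsCMField.complexConj L) hw) (UnitaryGroup.placeForm H w.1))]
        [BorelSpace ↥(lieOfForm (galAdicCompletionMap (L := L) (IsCMField.complexConj L) hw) (UnitaryGroup.placeForm H w.1))]
        (μ𝔤 : Measure ↥(lieOfForm (galAdicCompletionMap (L := L) (IsCMField.complexConj L) hw) (UnitaryGroup.placeForm H w.1))) [μ𝔤.IsAddHaarMeasure]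
        [MeasurableSpace ↥(unitaryGroupOfForm (galAdicCompletionMap (L := L) (IsCMField.complexConj L) hw) (UnitaryGroup.placeForm H w.1))]
        [BorelSpace ↥(unitaryGroupOfForm (galAdicCompletionMap (L := L) (IsCMField.complexConj L) hw) (UnitaryGroup.placeForm H w.1))]
        (μ₀ : Measure ↥(unitaryGroupOfForm (galAdicCompletionMap (L := L) (IsCMField.complexConj L) hw) (UnitaryGroup.placeForm H w.1))) [μ₀.IsHaarMeasure]
        (r₀ : SmoothIrrep ↥(unitaryGroupOfForm (galAdicCompletionMap (L := L) (IsCMField.complexConj L) hw) (UnitaryGroup.placeForm H w.1))), r₀.ρ.IsAdmissible →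
        ∀ Θ₀ : ↥(unitaryGroupOfForm (galAdicCompletionMap (L := L) (IsCMField.complexConj L) hw) (UnitaryGroup.placeForm H w.1)) → ℂ,
        (∀ x₀ : ↥(unitaryGroupOfForm (galAdicCompletionMap (L := L) (IsCMField.complexConj L) hw) (UnitaryGroup.placeForm H w.1)),
          IsRegularElt (x₀ : GL (Fin N) (w.1.adicCompletion L)) → ∀ᶠ y in 𝓝 x₀, Θ₀ y = Θ₀ x₀) →
        (∀ φ₀ : ↥(unitaryGroupOfForm (galAdicCompletionMap (L := L) (IsCMField.complexConj L) hw) (UnitaryGroup.placeForm H w.1)) → ℂ,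
          IsLocSmooth φ₀ → (IrrClass.mk r₀).smoothTrace μ₀ φ₀ = ∫ x, φ₀ x * Θ₀ x ∂μ₀) →
      ∃ V : Set (Matrix (Fin N) (Fin N) (w.1.adicCompletion L)), V ∈ 𝓝 (0 : Matrix (Fin N) (Fin N) (w.1.adicCompletion L)) ∧
      ∃ T : (↥(lieOfForm (galAdicCompletionMap (L := L) (IsCMField.complexConj L) hw) (UnitaryGroup.placeForm H w.1)) → ℂ) → ℂ,
        ((∀ f₁ f₂ : ↥(lieOfForm (galAdicCompletionMap (L := L) (IsCMField.complexConj L) hw) (UnitaryGroup.placeForm H w.1)) → ℂ, IsLocSmooth f₁ → IsLocSmooth f₂ → T (f₁ + f₂) = T f₁ + T f₂) ∧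
         (∀ (a : ℂ) (f : ↥(lieOfForm (galAdicCompletionMap (L := L) (IsCMField.complexConj L) hw) (UnitaryGroup.placeForm H w.1)) → ℂ), IsLocSmooth f → T (a • f) = a * T f) ∧
         (∀ (x : ↥(unitaryGroupOfForm (galAdicCompletionMap (L := L) (IsCMField.complexConj L) hw) (UnitaryGroup.placeForm H w.1))) (f : ↥(lieOfForm (galAdicCompletionMap (L := L) (IsCMField.complexConj L) hw) (UnitaryGroup.placeForm H w.1)) → ℂ), IsLocSmooth f →
            T (fun X => f ⟨((x : GL (Fin N) (w.1.adicCompletion L)) : Matrix (Fin N) (Fin N) (w.1.adicCompletion L)) * X.1 * (((x : GL (Fin N) (w.1.adicCompletion L))⁻¹ : GL (Fin N) (w.1.adicCompletion L)) : Matrix (Fin N) (Fin N) (w.1.adicCompletion L)),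
              conj_mem_lieOfForm x.2 X.2⟩) = T f) ∧
         (∀ f : ↥(lieOfForm (galAdicCompletionMap (L := L) (IsCMField.complexConj L) hw) (UnitaryGroup.placeForm H w.1)) → ℂ, IsLocSmooth f → (∀ X ∈ tsupport f, ¬ IsNilpotent X.1) → T f = 0)) ∧
        ∀ Fn : ↥(lieOfForm (galAdicCompletionMap (L := L) (IsCMField.complexConj L) hw) (UnitaryGroup.placeForm H w.1)) → ℂ,
          (∀ f : ↥(lieOfForm (galAdicCompletionMap (L := L) (IsCMField.complexConj L) hw) (UnitaryGroup.placeForm H w.1)) → ℂ, IsLocSmooth f → T (lieFourier (galAdicCompletionMap (L := L) (IsCMField.complexConj L) hw) (UnitaryGroup.placeForm H w.1) (fun x : w.1.adicCompletion L => ((ψ x : Circle) : ℂ)) μ𝔤 f) = ∫ X, f X * Fn X ∂μ𝔤) →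
          (∀ X : ↥(lieOfForm (galAdicCompletionMap (L := L) (IsCMField.complexConj L) hw) (UnitaryGroup.placeForm H w.1)), IsUnit X.1.charpoly.discr → ∀ᶠ Y in 𝓝 X, Fn Y = Fn X) →
          ∀ g : ↥(unitaryGroupOfForm (galAdicCompletionMap (L := L) (IsCMField.complexConj L) hw) (UnitaryGroup.placeForm H w.1)), ∀ Y : ↥(lieOfForm (galAdicCompletionMap (L := L) (IsCMField.complexConj L) hw) (UnitaryGroup.placeForm H w.1)), Y.1 ∈ V → IsUnit Y.1.charpoly.discr → IsUnit (1 - Y.1) → IsUnit (1 + Y.1) →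
            ((g : GL (Fin N) (w.1.adicCompletion L)) : Matrix (Fin N) (Fin N) (w.1.adicCompletion L)) = (1 + Y.1) * (1 - Y.1)⁻¹ → Θ₀ g = Fn Y := by
  intro L _ _ _ N hN2 hN3
  obtain rfl | rfl : N = 2 ∨ N = 3 := by omega
  · exact sig_K2E3ULieCharExpansionAtOneTwo L
  · exact sig_K2E3ULieCharExpansionAtOneThree L

/-! ## §2 (L-B_U)′₃ ⟸ ★ (LBU at N = 2, «LIE» ED. 14 body) ∣ (LBU-3) -/

set_option maxHeartbeats 1600000 in
set_option synthInstance.maxHeartbeats 400000 in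
open scoped Classical in
open MeasureTheory.Measure Filter Topology Polynomial Literature.NumberTheory.GaloisRepresentations.IsNonarchimedeanLocalField Summit.HodgeConjecture.HodgeConjecture.Cruxes.H413.K2E3LieUnitary in
/-- **(L-B_U)′₃** — the `hBU` hypothesis of ★ glue₃ VERBATIM, tied by `N` (`N = 2`: ★ `u2_nilpotentFourierRegular_of_gl2Nm` ∘ ★ (LBU-2⁺) `sig_K2E3GL2NmNilpotentFourierRegular`, as «LIE» :555). -/
theorem uNilpotentFourierRegular_leThree :
    ∀ (L : Type) [Field L] [NumberField L] [IsCMField L] (N : ℕ), 2 ≤ N → N ≤ 3 → ∀ (H : Matrix (Fin N) (Fin N) L),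
      (H.map (cmConjRingHom L))ᵀ = H → H.det ≠ 0 →
      ∀ (v : HeightOneSpectrum (𝓞 ↥(maximalRealSubfield L))) (w : UnitaryGroup.PlacesOver L v) (hw : IsCMField.complexConj L • w.1 = w.1)
      (ψ : AddChar (w.1.adicCompletion L) Circle), ψ.IsContinuousNontrivial →
      (∃ a : w.1.adicCompletion L, galAdicCompletionMap (L := L) (IsCMField.complexConj L) hw a = a ∧ ψ a ≠ 1) →
      ∀ [MeasurableSpace ↥(lieOfForm (galAdicCompletionMap (L := L) (IsCMField.complexConj L) hw) (UnitaryGroup.placeForm H w.1))]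
        [BorelSpace ↥(lieOfForm (galAdicCompletionMap (L := L) (IsCMField.complexConj L) hw) (UnitaryGroup.placeForm H w.1))]
        (μ𝔤 : Measure ↥(lieOfForm (galAdicCompletionMap (L := L) (IsCMField.complexConj L) hw) (UnitaryGroup.placeForm H w.1))) [μ𝔤.IsAddHaarMeasure],
      ∀ T : (↥(lieOfForm (galAdicCompletionMap (L := L) (IsCMField.complexConj L) hw) (UnitaryGroup.placeForm H w.1)) → ℂ) → ℂ,
        ((∀ f₁ f₂ : ↥(lieOfForm (galAdicCompletionMap (L := L) (IsCMField.complexConj L) hw) (UnitaryGroup.placeForm H w.1)) → ℂ, IsLocSmooth f₁ → IsLocSmooth f₂ → T (f₁ + f₂) = T f₁ + T f₂) ∧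
         (∀ (a : ℂ) (f : ↥(lieOfForm (galAdicCompletionMap (L := L) (IsCMField.complexConj L) hw) (UnitaryGroup.placeForm H w.1)) → ℂ), IsLocSmooth f → T (a • f) = a * T f) ∧
         (∀ (x : ↥(unitaryGroupOfForm (galAdicCompletionMap (L := L) (IsCMField.complexConj L) hw) (UnitaryGroup.placeForm H w.1))) (f : ↥(lieOfForm (galAdicCompletionMap (L := L) (IsCMField.complexConj L) hw) (UnitaryGroup.placeForm H w.1)) → ℂ), IsLocSmooth f →
            T (fun X => f ⟨((x : GL (Fin N) (w.1.adicCompletion L)) : Matrix (Fin N) (Fin N) (w.1.adicCompletion L)) * X.1 * (((x : GL (Fin N) (w.1.adicCompletion L))⁻¹ : GL (Fin N) (w.1.adicCompletion L)) : Matrix (Fin N) (Fin N) (w.1.adicCompletion L)),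
              conj_mem_lieOfForm x.2 X.2⟩) = T f) ∧
         (∀ f : ↥(lieOfForm (galAdicCompletionMap (L := L) (IsCMField.complexConj L) hw) (UnitaryGroup.placeForm H w.1)) → ℂ, IsLocSmooth f → (∀ X ∈ tsupport f, ¬ IsNilpotent X.1) → T f = 0)) →
        ∃ Fn : ↥(lieOfForm (galAdicCompletionMap (L := L) (IsCMField.complexConj L) hw) (UnitaryGroup.placeForm H w.1)) → ℂ, LocallyIntegrable Fn μ𝔤 ∧
          (∀ f : ↥(lieOfForm (galAdicCompletionMap (L := L) (IsCMField.complexConj L) hw) (UnitaryGroup.placeForm H w.1)) → ℂ, IsLocSmooth f → T (lieFourier (galAdicCompletionMap (L := L) (IsCMField.complexConj L) hw) (UnitaryGroup.placeForm H w.1) (fun x : w.1.adicCompletion L => ((ψ x : Circle) : ℂ)) μ𝔤 f) = ∫ X, f X * Fn X ∂μ𝔤) ∧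
          (∀ X : ↥(lieOfForm (galAdicCompletionMap (L := L) (IsCMField.complexConj L) hw) (UnitaryGroup.placeForm H w.1)), IsUnit X.1.charpoly.discr → ∀ᶠ Y in 𝓝 X, Fn Y = Fn X) ∧
          (∀ C : Set ↥(lieOfForm (galAdicCompletionMap (L := L) (IsCMField.complexConj L) hw) (UnitaryGroup.placeForm H w.1)), IsCompact C → ∃ B : ℝ, ∀ X ∈ C,
              ((NNReal.sqrt (NNReal.sqrt (normAbs (w.1.adicCompletion L) X.1.charpoly.discr)) : ℝ≥0) : ℝ) * ‖Fn X‖ ≤ B) := by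
  intro L _ _ _ N hN2 hN3
  obtain rfl | rfl : N = 2 ∨ N = 3 := by omega
  · intro H hH hdet v w hw ψ hψ hψι _ _ μ𝔤 _ T hT
    exact Summit.HodgeConjecture.HodgeConjecture.Cruxes.H413.K2E3U2NilpotentFourierRegularOfGL2.u2_nilpotentFourierRegular_of_gl2Nm L v w hw H hH hdet ψ hψ hψι
      (sig_K2E3GL2NmNilpotentFourierRegular L v w hw ψ hψ hψι) μ𝔤 T hT
  · exact sig_K2E3UNilpotentFourierRegularThree L

/-! ## §3 (12-D)₃ ⟸ ★ (12D-le2) ∣ «LIE3b» (12D-3ns) head -/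

set_option maxHeartbeats 1600000 in
set_option synthInstance.maxHeartbeats 400000 in
open scoped Classical in
open MeasureTheory.Measure Filter Topology Polynomial Literature.NumberTheory.GaloisRepresentations.IsNonarchimedeanLocalField Summit.HodgeConjecture.HodgeConjecture.Cruxes.H413.K2E3LieUnitary in
/-- **(12-D)₃** — the `hD` hypothesis of ★ glue₃ VERBATIM, tied by `N` (`N = 2`: ★ (12D-le2) «LIE» :591; `N = 3`: «LIE3b» sorry-free head `normalizedCharBddNearSingularDescentThreeNonsplit_of_sigs`, REL over (12D-3U) + (12D-3tr)). -/
theorem normalizedCharBddNearSingularDescent_leThree :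
    ∀ (L : Type) [Field L] [NumberField L] [IsCMField L] (N : ℕ), 2 ≤ N → N ≤ 3 → ∀ (H : Matrix (Fin N) (Fin N) L),
      (H.map (cmConjRingHom L))ᵀ = H → H.det ≠ 0 →
      ∀ (v : HeightOneSpectrum (𝓞 ↥(maximalRealSubfield L))), (∀ w : PlacesOver L v, IsCMField.complexConj L • w.1 = w.1) → ∀
        [MeasurableSpace ((UnitaryGroup.cmDatum L N H).Local v)] [BorelSpace ((UnitaryGroup.cmDatum L N H).Local v)]
        (μ : Measure ((UnitaryGroup.cmDatum L N H).Local v)) [μ.IsHaarMeasure]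
        (c : IrrClass ((UnitaryGroup.cmDatum L N H).Local v)) (Θ : (UnitaryGroup.cmDatum L N H).Local v → ℂ),
        LocallyIntegrable Θ μ →
        (∀ x : (UnitaryGroup.cmDatum L N H).Local v,
          IsRegularElt (x.val : GL (Fin N) (UnitaryGroup.LocalRing L v)) → ∀ᶠ y in 𝓝 x, Θ y = Θ x) →
        (∀ φ : (UnitaryGroup.cmDatum L N H).Local v → ℂ, IsLocSmooth φ → c.smoothTrace μ φ = ∫ x, φ x * Θ x ∂μ) →
      ∀ s : (UnitaryGroup.cmDatum L N H).Local v, Module.End.IsSemisimple (Matrix.toLin' ((s.val : GL (Fin N) (UnitaryGroup.LocalRing L v)).val : Matrix (Fin N) (Fin N) (UnitaryGroup.LocalRing L v))) →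
        ¬ IsRegularElt (s.val : GL (Fin N) (UnitaryGroup.LocalRing L v)) → s ∉ Subgroup.center ((UnitaryGroup.cmDatum L N H).Local v) →
        ∃ U : Set ((UnitaryGroup.cmDatum L N H).Local v), IsOpen U ∧ s ∈ U ∧
        ∃ B : ℝ, ∀ g ∈ U, ∀ u : (UnitaryGroup.LocalRing L v)ˣ,
          (u : UnitaryGroup.LocalRing L v) *
              (((g.val : GL (Fin N) (UnitaryGroup.LocalRing L v)).val : Matrix (Fin N) (Fin N) (UnitaryGroup.LocalRing L v)).det) ^ (N - 1) =
            (((g.val : GL (Fin N) (UnitaryGroup.LocalRing L v)).val : Matrix (Fin N) (Fin N) (UnitaryGroup.LocalRing L v)).charpoly).discr →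
          ((NNReal.sqrt (NNReal.sqrt (unitModulusChar (UnitaryGroup.LocalRing L v) u)) : ℝ≥0) : ℝ) * ‖Θ g‖ ≤ B := by
  intro L _ _ _ N hN2 hN3
  obtain rfl | rfl : N = 2 ∨ N = 3 := by omega
  · intro H hH hHd v _
    exact sig_K2E3NormalizedCharBddNearSingularDescentLeTwo L 2 le_rfl H hH hHd v
  · intro H hH hHd v hns
    exact normalizedCharBddNearSingularDescentThreeNonsplit_of_sigs L H hH hHd v hns

/-! ## §4 ROW 12₃ := glue₃ §3 -/

set_option maxHeartbeats 1600000 in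
set_option synthInstance.maxHeartbeats 400000 in
open Filter Topology Pointwise Summit.HodgeConjecture.HodgeConjecture.Cruxes.H413.F0P3cStCharTSTorusDefs in
open scoped Classical in
/-- **ROW 12₃ `sig_K2E3NormalizedCharBddNearSemisimpleLeThree`** — row 12 `sig_K2E3NormalizedCharBddNearSemisimple` RE-CUT (`2 ≤ N ≤ 3`, `v` non-split) = the `hd` hypothesis of ★ `K2E3CharLocBddOfLocalLeThree.charLocBddOfLocal`; tied BY NAME to glue₃ §3. -/
theorem sig_K2E3NormalizedCharBddNearSemisimpleLeThree :
    ∀ (L : Type) [Field L] [NumberField L] [IsCMField L] (N : ℕ), 2 ≤ N → N ≤ 3 → ∀ (H : Matrix (Fin N) (Fin N) L),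
      (H.map (cmConjRingHom L))ᵀ = H → H.det ≠ 0 →
      ∀ (v : HeightOneSpectrum (𝓞 ↥(maximalRealSubfield L))), (∀ w : PlacesOver L v, IsCMField.complexConj L • w.1 = w.1) → ∀
        [MeasurableSpace ((UnitaryGroup.cmDatum L N H).Local v)] [BorelSpace ((UnitaryGroup.cmDatum L N H).Local v)]
        (μ : Measure ((UnitaryGroup.cmDatum L N H).Local v)) [μ.IsHaarMeasure]
        (c : IrrClass ((UnitaryGroup.cmDatum L N H).Local v)) (Θ : (UnitaryGroup.cmDatum L N H).Local v → ℂ),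
        LocallyIntegrable Θ μ →
        (∀ x : (UnitaryGroup.cmDatum L N H).Local v,
          IsRegularElt (x.val : GL (Fin N) (UnitaryGroup.LocalRing L v)) → ∀ᶠ y in 𝓝 x, Θ y = Θ x) →
        (∀ φ : (UnitaryGroup.cmDatum L N H).Local v → ℂ, IsLocSmooth φ → c.smoothTrace μ φ = ∫ x, φ x * Θ x ∂μ) →
      ∀ s : (UnitaryGroup.cmDatum L N H).Local v, Module.End.IsSemisimple (Matrix.toLin' ((s.val : GL (Fin N) (UnitaryGroup.LocalRing L v)).val : Matrix (Fin N) (Fin N) (UnitaryGroup.LocalRing L v))) →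
        ∃ U : Set ((UnitaryGroup.cmDatum L N H).Local v), IsOpen U ∧ s ∈ U ∧
        ∃ B : ℝ, ∀ g ∈ U, ∀ u : (UnitaryGroup.LocalRing L v)ˣ,
          (u : UnitaryGroup.LocalRing L v) *
              (((g.val : GL (Fin N) (UnitaryGroup.LocalRing L v)) : Matrix (Fin N) (Fin N) (UnitaryGroup.LocalRing L v)).det) ^ (N - 1) =
            (((g.val : GL (Fin N) (UnitaryGroup.LocalRing L v)) : Matrix (Fin N) (Fin N) (UnitaryGroup.LocalRing L v)).charpoly).discr →
          ((NNReal.sqrt (NNReal.sqrt (unitModulusChar (UnitaryGroup.LocalRing L v) u)) : ℝ≥0) : ℝ) * ‖Θ g‖ ≤ B :=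
  Summit.HodgeConjecture.HodgeConjecture.Cruxes.H413.K2E3NormalizedCharBddOnCayleySliceOfLieCoreFixedLeThree.normalizedCharBddNearSemisimple_of_lieCore'
    sig_K2E3LocalIrrepAdmissible uLieCharExpansionAtOne_leThree uNilpotentFourierRegular_leThree normalizedCharBddNearSingularDescent_leThree

/-! ## §5 ROW 11₃ ⟸ (11-2-nonsplit) ∣ `charLocIntNearSemisimple_three_nonsplit_of_leaves` -/

set_option maxHeartbeats 1600000 in
set_option synthInstance.maxHeartbeats 400000 in
open Filter Topology Pointwise Summit.HodgeConjecture.HodgeConjecture.Cruxes.H413.F0P3cStCharTSTorusDefs in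
open scoped Classical in
/-- **ROW 11₃ `sig_K2E3CharLocIntNearSemisimpleLeThree`** — row 11 RE-CUT = the `hc` hypothesis of ★ `K2E3CharLocIntOfLocalLeThree.charLocIntOfLocal_of_localIrrepAdmissible`; `N = 2`: (11-2-nonsplit) `sig_K2E3CharLocIntNearSemisimpleNonsplitTwo` (MAIN, REL over PART «RANK»); `N = 3`: MAIN's `charLocIntNearSemisimple_three_nonsplit_of_leaves` (REL over (11-3ns-res)). -/
theorem sig_K2E3CharLocIntNearSemisimpleLeThree :
    ∀ (L : Type) [Field L] [NumberField L] [IsCMField L] (N : ℕ), 2 ≤ N → N ≤ 3 → ∀ (H : Matrix (Fin N) (Fin N) L),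
      (H.map (cmConjRingHom L))ᵀ = H → H.det ≠ 0 →
      ∀ (v : HeightOneSpectrum (𝓞 ↥(maximalRealSubfield L))), (∀ w : PlacesOver L v, IsCMField.complexConj L • w.1 = w.1) → ∀
        [MeasurableSpace ((UnitaryGroup.cmDatum L N H).Local v)] [BorelSpace ((UnitaryGroup.cmDatum L N H).Local v)]
        (μ : Measure ((UnitaryGroup.cmDatum L N H).Local v)) [μ.IsHaarMeasure]
        (c : IrrClass ((UnitaryGroup.cmDatum L N H).Local v)),
        ∀ s : (UnitaryGroup.cmDatum L N H).Local v, Module.End.IsSemisimple (Matrix.toLin' ((s.val : GL (Fin N) (UnitaryGroup.LocalRing L v)).val : Matrix (Fin N) (Fin N) (UnitaryGroup.LocalRing L v))) →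
          ∃ U : Set ((UnitaryGroup.cmDatum L N H).Local v), IsOpen U ∧ s ∈ U ∧
            ∃ Θ : (UnitaryGroup.cmDatum L N H).Local v → ℂ, IntegrableOn Θ U μ ∧
              ∀ f : (UnitaryGroup.cmDatum L N H).Local v → ℂ, f ∈ SchwartzBruhat ((UnitaryGroup.cmDatum L N H).Local v) → tsupport f ⊆ U →
                c.smoothTrace μ f = ∫ g, f g * Θ g ∂μ := by
  intro L _ _ _ N hN2 hN3
  obtain rfl | rfl : N = 2 ∨ N = 3 := by omega
  · intro H hH hHd v hns _ _ μ _ c s hs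
    exact sig_K2E3CharLocIntNearSemisimpleNonsplitTwo L H hH hHd v hns μ c s hs
  · intro H hH hHd v hns _ _ μ _ c s hs
    exact charLocIntNearSemisimple_three_nonsplit_of_leaves L H hH hHd v hns μ c s hs

/-! ## §6 ROW 9₃ := restriction of ★ row 9 -/

set_option maxHeartbeats 1600000 in
set_option synthInstance.maxHeartbeats 400000 in
open Filter Topology Pointwise Summit.HodgeConjecture.HodgeConjecture.Cruxes.H413.F0P3cStCharTSTorusDefs in
open scoped Classical in
/-- **ROW 9₃ `sig_K2E3CharLocConstOnRegularSetLeThree`** — row 9 RE-CUT = the `ha` hypothesis of ★ `K2E3CharLocIntOfLocalLeThree.charLocIntOfLocal_of_localIrrepAdmissible`; ★ row 9 holds for every `N` and `v`. -/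
theorem sig_K2E3CharLocConstOnRegularSetLeThree :
    ∀ (L : Type) [Field L] [NumberField L] [IsCMField L] (N : ℕ), 2 ≤ N → N ≤ 3 → ∀ (H : Matrix (Fin N) (Fin N) L),
      (H.map (cmConjRingHom L))ᵀ = H → H.det ≠ 0 →
      ∀ (v : HeightOneSpectrum (𝓞 ↥(maximalRealSubfield L))), (∀ w : PlacesOver L v, IsCMField.complexConj L • w.1 = w.1) → ∀
        [MeasurableSpace ((UnitaryGroup.cmDatum L N H).Local v)] [BorelSpace ((UnitaryGroup.cmDatum L N H).Local v)]
        (μ : Measure ((UnitaryGroup.cmDatum L N H).Local v)) [μ.IsHaarMeasure]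
        (c : IrrClass ((UnitaryGroup.cmDatum L N H).Local v)),
        ∃ Θ : (UnitaryGroup.cmDatum L N H).Local v → ℂ,
          IsLocallyConstant (fun g : {g : (UnitaryGroup.cmDatum L N H).Local v // IsRegularElt (g.1 : GL (Fin N) (UnitaryGroup.LocalRing L v))} => Θ g.1) ∧
          ∀ f : (UnitaryGroup.cmDatum L N H).Local v → ℂ, f ∈ SchwartzBruhat ((UnitaryGroup.cmDatum L N H).Local v) →
            tsupport f ⊆ {g : (UnitaryGroup.cmDatum L N H).Local v | IsRegularElt (g.val : GL (Fin N) (UnitaryGroup.LocalRing L v))} →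
            c.smoothTrace μ f = ∫ g, f g * Θ g ∂μ :=
  fun L _ _ _ N _ _ H hH hHd v _ => sig_K2E3CharLocConstOnRegularSet L N H hH hHd v

/-! ## §7 THE NARROWED LETTERS (tier-0 ED. 4 `stub_charLocInt` ∕ `stub_charLocBdd`) -/

set_option maxHeartbeats 1600000 in
set_option synthInstance.maxHeartbeats 400000 in
open Filter Topology Pointwise Summit.HodgeConjecture.HodgeConjecture.Cruxes.H413.F0P3cStCharTSTorusDefs in
open scoped Classical in
/-- **hHC₃ ⟸ U12-g + row 10 + ROW 11₃ + ROW 9₃** by ★ p861569. -/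
theorem charLocInt_of_sigs₃ :
    Summit.HodgeConjecture.HodgeConjecture.Cruxes.H413.K2E3CharLettersLeThreeDefs.characterLocallyIntegrableLeThree :=
  Summit.HodgeConjecture.HodgeConjecture.Cruxes.H413.K2E3CharLocIntOfLocalLeThree.charLocIntOfLocal_of_localIrrepAdmissible
    sig_K2E3LocalIrrepAdmissible sig_K2E3OrbitClosureContainsSemisimple sig_K2E3CharLocIntNearSemisimpleLeThree sig_K2E3CharLocConstOnRegularSetLeThree

set_option maxHeartbeats 1600000 in
set_option synthInstance.maxHeartbeats 400000 in
open Filter Topology Pointwise Summit.HodgeConjecture.HodgeConjecture.Cruxes.H413.F0P3cStCharTSTorusDefs in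
open scoped Classical in
/-- **hHCB₃ ⟸ row 10 + ROW 12₃** by ★ p861574. -/
theorem charLocBdd_of_sigs₃ :
    Summit.HodgeConjecture.HodgeConjecture.Cruxes.H413.K2E3CharLettersLeThreeDefs.normalizedCharacter_locallyBoundedLeThree :=
  Summit.HodgeConjecture.HodgeConjecture.Cruxes.H413.K2E3CharLocBddOfLocalLeThree.charLocBddOfLocal
    sig_K2E3OrbitClosureContainsSemisimple sig_K2E3NormalizedCharBddNearSemisimpleLeThree

end Summit.HodgeConjecture.HodgeConjecture.Cruxes.H413.K2E3EllipticInputs.U12Characters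

end
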